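import Literature.NumberTheory.EllipticCurves.ManinConstantGoodPrimesProofs
import Literature.NumberTheory.EllipticCurves.HondaStrongIsomorphismMultiplicativeProofs
import HarnessLib

/-!
# The Manin constant is a unit at every multiplicative prime `p ≥ 5` (finite-height route; proofs only)

Topic `NumberTheory/EllipticCurves` (theorems only; no definition, no named fact). Sequel of
`ManinConstantGoodPrimesProofs` (the same at a good prime `p ≥ 5`), in support of the named fact
`Literature.NumberTheory.EllipticCurves.edixhoven_int_of_neronLattice_eq_smul_periodLattice`
(Edixhoven 1991, Prop. 2: `c_f ∈ ℤ`). For its data — a globally minimal `W'/ℚ`, `f ∈ S₂(Γ₀(N))`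
with `IsNewformOf W' f`, a Néron-type period pair `L'` of `W'`, `q ∈ ℚ` with `Λ_{L'} = q Λ_f`
exactly — we prove

  `padicNorm_le_one_of_neronLattice_eq_smul_periodLattice_of_dvd_of_not_dvd`:
  `‖q‖_p ≤ 1` for every prime `p ≥ 5` of MULTIPLICATIVE reduction (`p ∣ Δ_min(W')`, `p ∤ c₄`),

hence (`…_of_not_additive`, with the good-prime theorem) at every `p ≥ 5` that is not additive
(`¬ (p ∣ Δ_min ∧ p ∣ c₄)`), and (`dvd_six_or_additive_of_dvd_den_of_neronLattice_eq_smul_periodLattice`)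
every prime factor `p` of `den q` is `2`, `3`, or a prime of additive reduction; for a semistable
`W'` the denominator of `q` is a `{2, 3}`-number (`eq_two_or_eq_three_of_dvd_den_of_semistable`). For
the strong Weil curve `|q| = c_f`: the Manin constant is a `p`-adic unit at every `p ≥ 5` with
`v_p(N) ≤ 1` — the theorem of Mazur (1978) and Abbes–Ullmo (1996) (`p ∤ c_f` if `v_p(N) ≤ 1`, given
`c_f ∈ ℤ`; Pasten 2024, §10.1, p. 33), obtained here without Néron models or `X₀(N)_ℤ`.

The proof is the finite-height argument of `ManinConstantGoodPrimesProofs` (steps 1–5 of its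
docstring) with its two arithmetic inputs at `p` abstracted
(`padicNorm_le_one_of_neronLattice_eq_smul_periodLattice_of_formalMul_ne_zero`):
(i) FINITE HEIGHT `[p]˜ ≠ 0` for the reduction of the minimal model, and (ii) HONDA's strong
isomorphism `Σ aₙ(W')Xⁿ/n = log_{W'}(ψ)`, `ψ ∈ Xℤ_p⟦X⟧`. At a multiplicative prime (ii) is
`exists_padicInt_formalLog_subst_eq_lSeriesLog_of_dvd_of_not_dvd`
(`HondaStrongIsomorphismMultiplicativeProofs`), and (i) follows from Honda's congruence
`hondaShift p (±(1+p)) log_{W'} ∈ ℤ_p⟦X⟧` (`NodalReductionHondaTypeProofs`) by an elementary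
remark proved here (`formalMul_prime_map_toZMod_ne_zero_of_hondaShift`): if `[p] ≡ 0 (mod p)` then
`p·log = log([p]) ≡ log(0) = 0 (mod p)`, so `log ∈ ℤ_p⟦X⟧`, while the `Xᵖ`-coefficient of
`hondaShift p a log` is `c_p − a/p` with `‖a/p‖ = p > 1` for a unit `a` — so a formal group of
Honda type `p − aT + T²` with `a ∈ ℤ_pˣ` has height `1`, in particular finite height.

## References

* B. Edixhoven, *On the Manin constants of modular elliptic curves*, in: Arithmetic Algebraic
  Geometry (Texel, 1989), Progr. Math. 89 (1991), 25–39, Prop. 2. [EdixhovenManin1991]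
* H. Pasten, *Shimura curves and the abc conjecture*, J. Number Theory (2024), §10.1 (p. 33).
  [PastenShimura2024]
* B. Mazur, *Rational isogenies of prime degree*, Invent. Math. 44 (1978), 129–162, Cor. 4.1.
* A. Abbes, E. Ullmo, *À propos de la conjecture de Manin pour les courbes elliptiques modulaires*,
  Compositio Math. 103 (1996), 269–286, Thm. A.
* T. Honda, *On the theory of commutative formal groups*, J. Math. Soc. Japan 22 (1970), 213–246,
  Thm. 9 (pp. 240–241), and *Formal groups and zeta-functions*, Osaka J. Math. 5 (1968), Thm. 5.
  [Honda1970]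
* J. H. Silverman, *The Arithmetic of Elliptic Curves*, 2nd ed. (2009), IV.7 (height), VII.5.
  [SilvermanAEC2009]
-/

noncomputable section

open scoped Classical

namespace WeierstrassCurve

open PowerSeries Literature.NumberTheory.EllipticCurves Literature.RingTheory.FormalGroups

/-! ### Finite height from a Honda type with unit middle coefficient, and at a node -/

section FiniteHeight

variable {p : ℕ} [hp : Fact p.Prime] (V : WeierstrassCurve ℤ_[p])

/-- **A formal group of Honda type `p − aT + T²` with `a ∈ ℤ_pˣ` has `[p]˜ ≠ 0`.** For `V/ℤ_p`
with generic fibre `W`: if `hondaShift p a log_W ∈ ℤ_p⟦X⟧` with `‖a‖ = 1`, then the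
multiplication by `p` of the reduction `Ṽ` is not the zero series. (If `[p]_V ≡ 0 (mod p)` then
`p·log_W = log_W([p]_V) ≡ log_W(0) = 0 (mod p)` coefficientwise, so `‖c_p‖ ≤ 1` for the
`Xᵖ`-coefficient `c_p` of `log_W`; but the `Xᵖ`-coefficient of `hondaShift p a log_W` is
`c_p − a/p`, of norm `p > 1`.) [Honda 1970, §2 (a type `p − aT + ⋯` with `a` a unit has height 1)]
[cite: Honda1970, Thm. 2 (p. 223)] -/
theorem formalMul_prime_map_toZMod_ne_zero_of_hondaShift {a : ℚ_[p]} (ha : ‖a‖ = 1)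
    (hT : ∀ n, ‖coeff n (hondaShift p a (V.map PadicInt.Coe.ringHom).formalLog)‖ ≤ 1) :
    (V.map PadicInt.toZMod).formalMul p ≠ 0 := by
  intro h0
  haveI := V.isIntegral_map_coe
  set W := V.map PadicInt.Coe.ringHom with hWdef
  have hp0 : (p : ℚ_[p]) ≠ 0 := by exact_mod_cast hp.out.ne_zero
  have hpr : (0 : ℝ) < (p : ℝ)⁻¹ := inv_pos.mpr (by exact_mod_cast hp.out.pos)
  -- `[p]_V ≡ 0 (mod p)`
  have hV : PowerSeries.map PadicInt.toZMod (V.formalMul p) = 0 := by rw [map_formalMul, h0]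
  set u : ℚ_[p]⟦X⟧ := (V.formalMul p).map PadicInt.Coe.ringHom with hu
  have hu' : u = W.formalMul p := by rw [hu, map_formalMul]
  have hu0 : constantCoeff u = 0 := by rw [hu', W.constantCoeff_formalMul]
  have hint : ∀ n, ‖coeff n u‖ ≤ 1 := fun n ↦ by rw [hu, coeff_map]; exact PadicInt.norm_le_one _
  have huv : ∀ n, ‖coeff n (u - 0)‖ ≤ (p : ℝ)⁻¹ := fun n ↦ by
    rw [sub_zero, hu]; exact norm_coeff_map_le_inv_of_map_toZMod hV n
  -- `log_W([p]) − log_W(0) = p · log_W ≡ 0 (mod p)`: `‖c_p‖ ≤ 1`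
  have key := norm_coeff_subst_sub_subst_le_of_natCast_mul_coeff_le W.norm_natCast_mul_coeff_formalLog_le
    hu0 hint (map_zero _) (fun n ↦ by rw [map_zero, norm_zero]; exact zero_le_one) huv p
  rw [hu', W.formalLog_subst_formalMul_rat p, subst_zero_eq_zero W.constantCoeff_formalLog, sub_zero,
    nsmul_eq_mul, ← map_natCast (C : ℚ_[p] →+* ℚ_[p]⟦X⟧) p, coeff_C_mul, norm_mul, Padic.norm_p,
    mul_le_iff_le_one_right hpr] at key
  -- the `Xᵖ`-coefficient of the Honda shift is `c_p − a/p`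
  have hpp : ¬ p ^ 2 ∣ p := fun h ↦ by
    have h' := Nat.le_of_dvd hp.out.pos h
    nlinarith [hp.out.two_le]
  have hTp := hT p
  rw [coeff_hondaShift, if_pos dvd_rfl, Nat.div_self hp.out.pos, coeff_one_formalLog, mul_one,
    if_neg hpp, mul_zero, add_zero] at hTp
  -- `‖a/p‖ ≤ max ‖c_p‖ ‖c_p − a/p‖ ≤ 1`, but `‖a/p‖ = p`
  have hap : ‖a / p‖ ≤ 1 := by
    have e : a / p = coeff p W.formalLog + -(coeff p W.formalLog - a / p) := by ring
    calc ‖a / p‖ = ‖coeff p W.formalLog + -(coeff p W.formalLog - a / p)‖ := by rw [← e]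
      _ ≤ max ‖coeff p W.formalLog‖ ‖-(coeff p W.formalLog - a / p)‖ := Padic.nonarchimedean _ _
      _ ≤ 1 := max_le key (by rw [norm_neg]; exact hTp)
  rw [norm_div, ha, Padic.norm_p, one_div, inv_inv] at hap
  exact absurd hap (not_le.mpr (by exact_mod_cast hp.out.one_lt))

/-- **The formal group of a nodal reduction has finite height: `[p]˜ ≠ 0`** for `V/ℤ_p` with
`Δ̃ = 0`, `c̃₄ ≠ 0` (multiplicative reduction) — by Honda's congruence
`hondaShift p (±(1+p)) log_W ∈ ℤ_p⟦X⟧` (`NodalReductionHondaTypeProofs`) and the previous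
remark. (Directly: `[p]˜` is `Xᵖ` or `ĩ(Xᵖ)` after moving the node to the origin.)
[cite: SilvermanAEC2009, IV.7 and VII.5] [cite: Honda1970, Thm. 9 (pp. 240–241)] -/
theorem formalMul_prime_map_toZMod_ne_zero_of_nodal (hΔ : (V.map PadicInt.toZMod).Δ = 0)
    (hc₄ : (V.map PadicInt.toZMod).c₄ ≠ 0) : (V.map PadicInt.toZMod).formalMul p ≠ 0 := by
  have h1 : ‖((1 + p : ℕ) : ℚ_[p])‖ = 1 := by
    rw [Padic.norm_natCast_eq_one_iff, Nat.coprime_add_self_right]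
    exact Nat.coprime_one_right p
  by_cases hs : letI E := V.map PadicInt.toZMod
      (Polynomial.C E.c₄ * Polynomial.X ^ 2 + Polynomial.C (E.a₁ * E.c₄) * Polynomial.X
        - Polynomial.C (54 * E.b₆ - 3 * E.b₂ * E.b₄ + E.a₂ * E.c₄)).Splits
  · exact V.formalMul_prime_map_toZMod_ne_zero_of_hondaShift h1
      (V.norm_coeff_hondaShift_formalLog_le_one_of_nodal_split hΔ hc₄ hs)
  · exact V.formalMul_prime_map_toZMod_ne_zero_of_hondaShift (by rw [norm_neg, h1])
      (V.norm_coeff_hondaShift_formalLog_le_one_of_nodal_nonsplit hΔ hc₄ hs)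

/-- **`[n]˜ ≠ 0` for every `n ≥ 1` as soon as `[p]˜ ≠ 0`**: `[pᵏm]˜ = [pᵏ]˜ ∘ [m]˜` with
`[m]˜ = mX + ⋯`, `p ∤ m`, and `[pᵏ]˜ = [p]˜ ∘ ⋯ ∘ [p]˜ ≠ 0` (the proof of
`formalMul_map_toZMod_ne_zero`, with its hypothesis made explicit). [cite: SilvermanAEC2009, IV.7] -/
theorem formalMul_map_toZMod_ne_zero_of_formalMul_prime_ne_zero
    (hP : (V.map PadicInt.toZMod).formalMul p ≠ 0) {n : ℕ} (hn : 0 < n) :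
    (V.map PadicInt.toZMod).formalMul n ≠ 0 := by
  set E := V.map PadicInt.toZMod with hEdef
  have hpow : ∀ k : ℕ, E.formalMul (p ^ k) ≠ 0 := by
    intro k
    induction k with
    | zero => rw [pow_zero]; intro h; have := congrArg (coeff 1) h
              rw [coeff_one_formalMul', Nat.cast_one, map_zero] at this; exact one_ne_zero this
    | succ k ih =>
      rw [pow_succ', ← E.formalMul_mul_subst' p (p ^ k)]
      exact subst_ne_zero_of_ne_zero hP (E.constantCoeff_formalMul _) ih
  obtain ⟨k, m, hm, rfl⟩ := Nat.exists_eq_pow_mul_and_not_dvd hn.ne' p hp.out.ne_one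
  rw [← E.formalMul_mul_subst' (p ^ k) m]
  refine subst_ne_zero_of_ne_zero (hpow k) (E.constantCoeff_formalMul m) fun h ↦ ?_
  have := congrArg (coeff 1) h
  rw [coeff_one_formalMul', map_zero] at this
  exact hm ((ZMod.natCast_eq_zero_iff m p).mp this)

/-- **Some coefficient of `[n](θ(X))` in positive degree is a `p`-adic unit** for `n ≥ 1` and
`θ = uX + ⋯ ∈ ℤ_p⟦X⟧`, `u ∈ ℤ_pˣ`, as soon as `[p]˜ ≠ 0` (the proof of
`exists_isUnit_coeff_formalMul_subst`, with its hypothesis made explicit) — the finite-height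
hypothesis of `Literature.RingTheory.PowerSeries.padicInt_exists_map_eq_of_subst_eq_map`.
[cite: SilvermanAEC2009, IV.7] -/
theorem exists_isUnit_coeff_formalMul_subst_of_formalMul_prime_ne_zero
    (hP : (V.map PadicInt.toZMod).formalMul p ≠ 0) {n : ℕ} (hn : 0 < n) {θ : ℤ_[p]⟦X⟧}
    (hθ0 : constantCoeff θ = 0) (hθ1 : IsUnit (coeff 1 θ)) :
    ∃ d : ℕ, 0 < d ∧ IsUnit (coeff d ((V.formalMul n).subst θ)) := by
  have hsθ : HasSubst θ := HasSubst.of_constantCoeff_zero' hθ0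
  have hms : PowerSeries.map PadicInt.toZMod ((V.formalMul n).subst θ) =
      ((V.map PadicInt.toZMod).formalMul n).subst (PowerSeries.map PadicInt.toZMod θ) := by
    rw [powerSeries_map_subst _ hsθ, map_formalMul]
  have hne : PowerSeries.map PadicInt.toZMod ((V.formalMul n).subst θ) ≠ 0 := by
    rw [hms]
    refine subst_ne_zero_of_isUnit_coeff_one
      (V.formalMul_map_toZMod_ne_zero_of_formalMul_prime_ne_zero hP hn) ?_ ?_
    · rw [← coeff_zero_eq_constantCoeff_apply, coeff_map, coeff_zero_eq_constantCoeff_apply, hθ0,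
        map_zero]
    · rw [coeff_map]; exact hθ1.map _
  obtain ⟨d, hd⟩ := exists_coeff_ne_zero_iff_ne_zero.mpr hne
  rw [coeff_map] at hd
  refine ⟨d, Nat.pos_of_ne_zero ?_, isUnit_of_toZMod_ne_zero hd⟩
  rintro rfl
  apply hd
  rw [coeff_zero_eq_constantCoeff_apply, constantCoeff_subst_eq_constantCoeff hθ0,
    V.constantCoeff_formalMul n, map_zero]

end FiniteHeight

end WeierstrassCurve

/-! ### `‖q‖_p ≤ 1` at a prime of finite height with a Honda witness; the multiplicative primes -/

namespace Literature.NumberTheory.EllipticCurves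

open PowerSeries Literature.RingTheory.FormalGroups Literature.NumberTheory.EllipticCurves.ModularForms
open Literature.NumberTheory.EllipticCurves.HondaCongruence Literature.NumberTheory.Automorphic
open _root_.WeierstrassCurve
open scoped MatrixGroups ModularForm
open CongruenceSubgroup

/-- **The Manin-constant multiplier is a `p`-adic integer at every prime `p ≥ 5` of finite height
with a Honda witness.** The data of `edixhoven_int_of_neronLattice_eq_smul_periodLattice`
(`W'/ℚ` globally minimal, `IsNewformOf W' f`, `Λ_{L'} = q Λ_f` exactly) and a prime `p ≥ 5` such
that (i) the reduction mod `p` of the minimal model has `[p]˜ ≠ 0` (finite height: good or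
multiplicative reduction) and (ii) `Σ aₙ(W')Xⁿ/n = log_{W'}(ψ)` for some `ψ ∈ Xℤ_p⟦X⟧` (Honda's
strong isomorphism) give `‖q‖_p ≤ 1`. This is steps 1–5 of `ManinConstantGoodPrimesProofs` with the
two arithmetic inputs abstracted (there: `p ∤ Δ_min`); the proof is otherwise verbatim.
[cite: EdixhovenManin1991, Prop. 2] [cite: PastenShimura2024, §10.1 (p. 33)]
[cite: Honda1970, Thm. 9 (pp. 240–241)] -/
theorem padicNorm_le_one_of_neronLattice_eq_smul_periodLattice_of_formalMul_ne_zero {N : ℕ} [NeZero N]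
    {W' : WeierstrassCurve ℚ} [W'.IsElliptic] [W'.IsGloballyMinimal] {f : CuspForm (Gamma0 N) 2}
    {L' : PeriodPair} (hf : IsNewformOf W' f) (hL' : IsNeronLatticeOf (W'.baseChange ℂ) L')
    {q : ℚ} (hq : ∀ z ∈ periodLattice f, (q : ℂ) * z ∈ L'.lattice)
    (hq' : ∀ z ∈ L'.lattice, ∃ w ∈ periodLattice f, z = q * w)
    {p : ℕ} [Fact p.Prime] (hp5 : 5 ≤ p)
    (hfin : ((integralModelInt W').map (Int.castRingHom (ZMod p))).formalMul p ≠ 0)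
    (hψex : ∃ ψ : ℚ_[p]⟦X⟧, constantCoeff ψ = 0 ∧ (∀ n, ‖coeff n ψ‖ ≤ 1) ∧
      (W'.map (algebraMap ℚ ℚ_[p])).formalLog.subst ψ =
        PowerSeries.mk fun k ↦ ((W'.LFunction k : ℤ) : ℚ_[p]) / k) :
    ‖(q : ℚ_[p])‖ ≤ 1 := by
  /- Step 1: lattices. `q ≠ 0`, `L := q⁻¹ L'` spans `Λ_f`, the short model `E` of `ℂ/Λ_f`. -/
  have hq0 : q ≠ 0 := by
    rintro rfl
    obtain ⟨w, -, hw⟩ := hq' L'.ω₁ L'.ω₁_mem_lattice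
    rw [Rat.cast_zero, zero_mul] at hw
    exact (LinearIndependent.ne_zero 0 L'.indep) (by simpa using hw)
  have hqC : (q : ℂ) ≠ 0 := by exact_mod_cast hq0
  set L : PeriodPair := L'.mulLeft ((q : ℂ)⁻¹) (inv_ne_zero hqC) with hLdef
  have hL : ∀ x, x ∈ L.lattice ↔ x ∈ periodLattice f := fun x ↦ by
    rw [hLdef, PeriodPair.mem_mulLeft_lattice, inv_inv]
    constructor
    · intro hx
      obtain ⟨w, hw, hxw⟩ := hq' _ hx
      rwa [mul_left_cancel₀ hqC hxw]
    · exact hq x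
  have hΛ : L'.lattice = (L.mulLeft (q : ℂ) hqC).lattice := by
    ext z
    rw [PeriodPair.mem_mulLeft_lattice, hL]
    constructor
    · intro hz
      obtain ⟨w, hw, rfl⟩ := hq' z hz
      rwa [← mul_assoc, inv_mul_cancel₀ hqC, one_mul]
    · intro hz
      have h := hq _ hz
      rwa [← mul_assoc, mul_inv_cancel₀ hqC, one_mul] at h
  have hf0 : f ≠ 0 := hf.1.ne_zero
  have ha : ∀ n, ((W'.LFunction n : ℤ) : ℂ) = cuspCoeff f n := fun n ↦ (hf.2 n).symm
  have hrat : ∀ n, ∃ r : ℚ, (r : ℂ) = cuspCoeff f n := fun n ↦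
    ⟨(W'.LFunction n : ℚ), by rw [← ha n, Rat.cast_intCast]⟩
  obtain ⟨⟨q₂, hq₂⟩, ⟨q₃, hq₃⟩⟩ :=
    PeriodPair.ratCast_g₂_g₃_of_lattice_eq_periodLattice f hf0 hrat L hL
  set a₄ : ℚ := -q₂ / 4 with ha₄
  set a₆ : ℚ := -q₃ / 4 with ha₆
  have h₂ : L.g₂ = -4 * (a₄ : ℂ) := by rw [← hq₂, ha₄]; push_cast; ring
  have h₃ : L.g₃ = -4 * (a₆ : ℂ) := by rw [← hq₃, ha₆]; push_cast; ring
  set E : WeierstrassCurve ℚ := { a₁ := 0, a₂ := 0, a₃ := 0, a₄ := a₄, a₆ := a₆ } with hE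
  haveI hEe : E.IsElliptic := isElliptic_shortModel h₂ h₃
  have hEL : IsNeronLatticeOf (E.baseChange ℂ) L := isNeronLatticeOf_shortModel h₂ h₃
  /- Step 2: the modular parametrisation as a formal series `z ∈ Xℚ⟦X⟧ ∩ Frac ℤ⟦X⟧`. -/
  obtain ⟨z, P, Q, hz0, hQ, hPQ, hlog⟩ := exists_rat_series_formalLog_subst_eq f hf0
    (W'.LFunction : ℕ → ℤ) ha L (fun x hx ↦ (hL x).mpr hx) a₄ a₆ h₂ h₃
  /- Step 3: `C • E = W'` over `ℚ` with `0 < u(C)` and `‖u(C)‖_p = ‖q‖_p`. -/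
  obtain ⟨e₄, e₆⟩ := hL'.c₄_eq_of_lattice_eq_mulLeft hqC hΛ
  have hc₄E : (E.baseChange ℂ).c₄ = (E.c₄ : ℂ) := by
    simp [WeierstrassCurve.baseChange, WeierstrassCurve.map_c₄]
  have hc₆E : (E.baseChange ℂ).c₆ = (E.c₆ : ℂ) := by
    simp [WeierstrassCurve.baseChange, WeierstrassCurve.map_c₆]
  have h₄ : W'.c₄ = (q ^ 4)⁻¹ * E.c₄ := by
    have h : ((W'.c₄ : ℚ) : ℂ) = (((q ^ 4)⁻¹ * E.c₄ : ℚ) : ℂ) := by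
      rw [e₄, hEL.1, hc₄E]; push_cast; ring
    exact_mod_cast h
  have h₆ : W'.c₆ = (q ^ 6)⁻¹ * E.c₆ := by
    have h : ((W'.c₆ : ℚ) : ℂ) = (((q ^ 6)⁻¹ * E.c₆ : ℚ) : ℂ) := by
      rw [e₆, hEL.2, hc₆E]; push_cast; ring
    exact_mod_cast h
  obtain ⟨vc, hC, hCpos⟩ : ∃ vc : VariableChange ℚ, vc • E = W' ∧ 0 < (vc.u : ℚ) := by
    obtain ⟨vc, hC⟩ := exists_variableChange_of_c₄_eq_of_c₆_eq hq0 h₄ h₆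
    rcases lt_or_gt_of_ne vc.u.ne_zero with hneg | hpos
    · have hE' : (⟨-1, 0, 0, 0⟩ : VariableChange ℚ) • E = E := by
        rw [hE, smul_shortModel, inv_neg_one]
        congr 1 <;> push_cast <;> ring
      refine ⟨vc * ⟨-1, 0, 0, 0⟩, by rw [mul_smul, hE', hC], ?_⟩
      show 0 < ((vc.u * -1 : ℚˣ) : ℚ)
      rw [Units.val_mul, Units.val_neg, Units.val_one]
      linarith
    · exact ⟨vc, hC, hpos⟩
  have hCu0 : (vc.u : ℚ) ≠ 0 := vc.u.ne_zero
  -- `‖u(vc)‖_p = ‖q‖_p`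
  have hnorm : ‖((vc.u : ℚ) : ℚ_[p])‖ = ‖(q : ℚ_[p])‖ := by
    have hW4 : W'.c₄ = ((vc.u : ℚ))⁻¹ ^ 4 * E.c₄ := by
      rw [← hC, variableChange_c₄, Units.val_inv_eq_inv_val]
    have hW6 : W'.c₆ = ((vc.u : ℚ))⁻¹ ^ 6 * E.c₆ := by
      rw [← hC, variableChange_c₆, Units.val_inv_eq_inv_val]
    have hΔ : E.c₄ ≠ 0 ∨ E.c₆ ≠ 0 := by
      by_contra hcon
      rw [not_or, not_not, not_not] at hcon
      have h1728 := E.c_relation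
      rw [hcon.1, hcon.2] at h1728
      exact E.isUnit_Δ.ne_zero (by linear_combination (1 / 1728 : ℚ) * h1728)
    have key : (vc.u : ℚ) ^ 4 = q ^ 4 ∨ (vc.u : ℚ) ^ 6 = q ^ 6 := by
      rcases hΔ with hc | hc
      · left
        have h' := mul_right_cancel₀ hc (hW4.symm.trans h₄)
        rw [inv_pow] at h'
        exact inv_injective h'
      · right
        have h' := mul_right_cancel₀ hc (hW6.symm.trans h₆)
        rw [inv_pow] at h'
        exact inv_injective h'
    rcases key with h | h
    · have h' : ‖((vc.u : ℚ) : ℚ_[p])‖ ^ 4 = ‖(q : ℚ_[p])‖ ^ 4 := by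
        rw [← norm_pow, ← norm_pow, ← Rat.cast_pow, ← Rat.cast_pow, h]
      exact (pow_left_inj₀ (norm_nonneg _) (norm_nonneg _) (by norm_num)).mp h'
    · have h' : ‖((vc.u : ℚ) : ℚ_[p])‖ ^ 6 = ‖(q : ℚ_[p])‖ ^ 6 := by
        rw [← norm_pow, ← norm_pow, ← Rat.cast_pow, ← Rat.cast_pow, h]
      exact (pow_left_inj₀ (norm_nonneg _) (norm_nonneg _) (by norm_num)).mp h'
  rw [← hnorm]
  /- Step 4: base change to `ℚ_p`; the scaled short model `E₀ = S • E` and `C₀ = C S⁻¹`. -/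
  set φ : ℚ →+* ℚ_[p] := algebraMap ℚ ℚ_[p] with hφ
  set Wp : WeierstrassCurve ℚ_[p] := W'.map φ with hWp
  set Ep : WeierstrassCurve ℚ_[p] := E.map φ with hEp
  set Cp : VariableChange ℚ_[p] := vc.map (φ : ℚ →+* ℚ_[p]) with hCp
  have hCE : Cp • Ep = Wp := by rw [hCp, hEp, hWp, map_variableChange, hC]
  have hCpu : (Cp.u : ℚ_[p]) = ((vc.u : ℚ) : ℚ_[p]) := by simp [hCp, VariableChange.map, hφ]
  rw [← hCpu]
  have hEp' : Ep = { a₁ := 0, a₂ := 0, a₃ := 0, a₄ := (a₄ : ℚ_[p]), a₆ := (a₆ : ℚ_[p]) } := by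
    simp [hEp, hE, WeierstrassCurve.map, hφ]
  set S : VariableChange ℚ_[p] := ⟨Cp.u, 0, 0, 0⟩ with hS
  set E₀ : WeierstrassCurve ℚ_[p] := S • Ep with hE₀
  set C₀ : VariableChange ℚ_[p] := Cp * S⁻¹ with hC₀
  have hC₀E₀ : C₀ • E₀ = Wp := by rw [hC₀, hE₀, mul_smul, inv_smul_smul, hCE]
  have hC₀u : C₀.u = 1 := by simp [hC₀, hS, VariableChange.mul_def, VariableChange.inv_def]
  haveI hE₀s : E₀.IsShortNF := by
    rw [hE₀, hS, hEp', smul_shortModel]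
    exact ⟨rfl, rfl, rfl⟩
  -- `C₀ = toShortNF⁻¹`, so `E₀ = toShortNF • Wp` is `p`-integral and `θ₀` is `p`-integral
  set V : WeierstrassCurve ℤ_[p] := (integralModelInt W').map (Int.castRingHom ℤ_[p]) with hV
  have hVc : V.map PadicInt.Coe.ringHom = Wp := map_coe_integralModelInt W'
  have hVt : V.map PadicInt.toZMod = (integralModelInt W').map (Int.castRingHom (ZMod p)) :=
    map_toZMod_integralModelInt W'
  haveI hWpI : Wp.IsIntegral ℤ_[p] := by rw [← hVc]; exact V.isIntegral_map_coe
  have hPV : (V.map PadicInt.toZMod).formalMul p ≠ 0 := by rw [hVt]; exact hfin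
  have hTC₀ : Wp.toShortNF * C₀ = 1 :=
    VariableChange.eq_one_of_isShortNF_smul (E := E₀) (E' := Wp.toShortNF • Wp)
      (by rw [VariableChange.mul_def]; simp [toShortNF_u, hC₀u]) (by rw [mul_smul, hC₀E₀])
  have hC₀T : C₀ = Wp.toShortNF⁻¹ := eq_inv_of_mul_eq_one_right hTC₀
  have hE₀T : E₀ = Wp.toShortNF • Wp := by
    rw [← inv_smul_eq_iff.mpr hC₀E₀.symm, hC₀T, inv_inv]
  haveI hE₀I : E₀.IsIntegral ℤ_[p] := by rw [hE₀T]; exact Wp.isIntegral_toShortNF_smul hp5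
  set θ₀ : ℚ_[p]⟦X⟧ := E₀.formalVariableChange C₀ with hθ₀
  have hθ₀0 : constantCoeff θ₀ = 0 := E₀.constantCoeff_formalVariableChange C₀
  have hθ₀1 : coeff 1 θ₀ = 1 := by rw [hθ₀, coeff_one_formalVariableChange, hC₀u, Units.val_one]
  have hθ₀s : HasSubst θ₀ := HasSubst.of_constantCoeff_zero' hθ₀0
  have hθ₀i : IsPadicInt θ₀ := by
    obtain ⟨hTu, hTr, hTs, hTt⟩ := Wp.norm_toShortNF_inv_le hp5
    rw [hθ₀, hC₀T]
    exact E₀.isPadicInt_formalVariableChange Wp.toShortNF⁻¹ hTu.le hTr hTs hTt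
  /- Step 5: the series over `ℚ_p` and their logarithms. -/
  set ℓ : ℚ_[p]⟦X⟧ := PowerSeries.mk fun k ↦ ((W'.LFunction k : ℤ) : ℚ_[p]) / k with hℓ
  set zp : ℚ_[p]⟦X⟧ := z.map φ with hzp
  have hzs : HasSubst z := HasSubst.of_constantCoeff_zero' hz0
  have hzp0 : constantCoeff zp = 0 := by
    rw [hzp, ← coeff_zero_eq_constantCoeff, coeff_map, coeff_zero_eq_constantCoeff, hz0, map_zero]
  have hzps : HasSubst zp := HasSubst.of_constantCoeff_zero' hzp0
  have hzp1 : coeff 1 zp = 1 := by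
    have h1 := congrArg (coeff 1) hlog
    rw [coeff_one_subst_eq_mul _ hz0, coeff_one_formalLog, one_mul, coeff_mk, Nat.cast_one,
      div_one, W'.isMultiplicative_LFunction.map_one, Int.cast_one] at h1
    rw [hzp, coeff_map, h1, map_one]
  have hlogp : Ep.formalLog.subst zp = ℓ := by
    rw [hzp, hEp, ← E.map_formalLog φ, ← powerSeries_map_subst hzs φ, hlog]
    ext n
    rw [coeff_map, coeff_mk, coeff_mk, map_div₀, map_natCast, map_intCast]
  set z₀ : ℚ_[p]⟦X⟧ := C (Cp.u : ℚ_[p]) * zp with hz₀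
  have hz₀0 : constantCoeff z₀ = 0 := by rw [hz₀, map_mul, hzp0, mul_zero]
  have hz₀s : HasSubst z₀ := HasSubst.of_constantCoeff_zero' hz₀0
  have hz₀1 : coeff 1 z₀ = (Cp.u : ℚ_[p]) := by rw [hz₀, coeff_C_mul, hzp1, mul_one]
  -- `log_{E₀}(u z) = u ℓ` and `log_{W'}(θ₀(u z)) = u ℓ`
  have hlog₀ : E₀.formalLog.subst z₀ = C (Cp.u : ℚ_[p]) * ℓ := by
    rw [hE₀, hz₀, hS, Ep.formalLog_uScale_smul_subst Cp.u hzp0, hlogp]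
  set t' : ℚ_[p]⟦X⟧ := θ₀.subst z₀ with ht'
  have ht'0 : constantCoeff t' = 0 :=
    (constantCoeff_subst_of_constantCoeff_eq_zero hz₀0).trans hθ₀0
  have ht's : HasSubst t' := HasSubst.of_constantCoeff_zero' ht'0
  have hlogW : Wp.formalLog.subst t' = C (Cp.u : ℚ_[p]) * ℓ := by
    rw [ht', ← subst_comp_subst_apply hθ₀s hz₀s, hθ₀, ← hC₀E₀, E₀.formalLog_variableChange_subst C₀,
      hC₀u, Units.val_one, map_one, one_mul, hlog₀]
  /- Step 6: Honda — `ℓ = log_{W'}(ψ)` with `ψ ∈ Xℤ_p⟦X⟧`. -/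
  obtain ⟨ψ, hψ0, hψi, hψ⟩ := hψex
  have hψ' : Wp.formalLog.subst ψ = ℓ := hψ
  have hψs : HasSubst ψ := HasSubst.of_constantCoeff_zero' hψ0
  have hψI : IsPadicInt ψ := isPadicInt_iff_coeff.mpr hψi
  /- Step 7: `u = n₁ / d` in lowest terms; `[d](t') = [n₁](ψ) =: w ∈ ℤ_p⟦X⟧`. -/
  set d : ℕ := (vc.u : ℚ).den with hd
  have hd0 : 0 < d := (vc.u : ℚ).den_pos
  have hnum : 0 < (vc.u : ℚ).num := Rat.num_pos.mpr hCpos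
  set n₁ : ℕ := (vc.u : ℚ).num.toNat with hn₁
  have hn₁z : ((n₁ : ℕ) : ℤ) = (vc.u : ℚ).num := Int.toNat_of_nonneg hnum.le
  have hdu : (d : ℚ_[p]) * (Cp.u : ℚ_[p]) = (n₁ : ℚ_[p]) := by
    have h : ((vc.u : ℚ)) * d = ((vc.u : ℚ).num : ℚ) := Rat.mul_den_eq_num _
    rw [← hn₁z] at h
    have h' := congrArg (fun r : ℚ ↦ (r : ℚ_[p])) h
    simp only [Rat.cast_mul, Rat.cast_natCast, Int.cast_natCast] at h'
    rw [hCpu, mul_comm]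
    exact h'
  set w : ℚ_[p]⟦X⟧ := (Wp.formalMul n₁).subst ψ with hw
  have hwI : IsPadicInt w := (Wp.isPadicInt_formalMul n₁).powerSeries_subst hψI hψs
  have hw0 : constantCoeff w = 0 :=
    (constantCoeff_subst_of_constantCoeff_eq_zero hψ0).trans (Wp.constantCoeff_formalMul n₁)
  have hlogw : Wp.formalLog.subst w = n₁ • ℓ := by
    rw [hw, ← subst_comp_subst_apply (Wp.hasSubst_formalMul n₁) hψs, Wp.formalLog_subst_formalMul n₁,
      ← coe_substAlgHom hψs, map_nsmul, coe_substAlgHom, hψ']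
  set G : ℚ_[p]⟦X⟧ := (Wp.formalMul d).subst θ₀ with hG
  have hGt' : G.subst z₀ = (Wp.formalMul d).subst t' := by
    rw [hG, ht', subst_comp_subst_apply hθ₀s hz₀s]
  have hdt'0 : constantCoeff ((Wp.formalMul d).subst t') = 0 :=
    (constantCoeff_subst_of_constantCoeff_eq_zero ht'0).trans (Wp.constantCoeff_formalMul d)
  have hlogd : Wp.formalLog.subst ((Wp.formalMul d).subst t') = n₁ • ℓ := by
    rw [← subst_comp_subst_apply (Wp.hasSubst_formalMul d) ht's, Wp.formalLog_subst_formalMul d,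
      ← coe_substAlgHom ht's, map_nsmul, coe_substAlgHom, hlogW, nsmul_eq_mul, nsmul_eq_mul,
      ← mul_assoc, ← map_natCast (C : ℚ_[p] →+* ℚ_[p]⟦X⟧) d, ← map_mul, hdu, map_natCast]
  have hGw : G.subst z₀ = w := by
    rw [hGt']
    exact Wp.eq_of_formalLog_subst_eq hdt'0 hw0 (hlogd.trans hlogw.symm)
  /- Step 8: integral lifts and the Weierstrass-preparation lemma. -/
  have halg : (algebraMap ℤ_[p] ℚ_[p] : ℤ_[p] →+* ℚ_[p]) = PadicInt.Coe.ringHom := rfl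
  obtain ⟨θ₁, hθ₁⟩ := isPadicInt_iff_exists_powerSeries_map.mp hθ₀i
  obtain ⟨w₁, hw₁⟩ := isPadicInt_iff_exists_powerSeries_map.mp hwI
  have hθ₁0 : constantCoeff θ₁ = 0 := by
    have h := hθ₀0
    rw [← hθ₁, ← coeff_zero_eq_constantCoeff, coeff_map, coeff_zero_eq_constantCoeff] at h
    exact PadicInt.coe_eq_zero.mp h
  have hθ₁1 : IsUnit (coeff 1 θ₁) := by
    have h := hθ₀1
    rw [← hθ₁, coeff_map] at h
    have h' : coeff 1 θ₁ = 1 := PadicInt.ext h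
    rw [h']
    exact isUnit_one
  have hθ₁s : HasSubst θ₁ := HasSubst.of_constantCoeff_zero' hθ₁0
  set G₁ : ℤ_[p]⟦X⟧ := (V.formalMul d).subst θ₁ with hG₁
  have hG₁ : G₁.map PadicInt.Coe.ringHom = G := by
    rw [hG₁, powerSeries_map_subst hθ₁s, map_formalMul, hθ₁, hVc, hG]
  obtain ⟨dd, hdd, hunit⟩ := V.exists_isUnit_coeff_formalMul_subst_of_formalMul_prime_ne_zero hPV hd0 hθ₁0 hθ₁1
  -- the `Frac ℤ_p⟦X⟧`-witness for `z₀ = u z`: `z₀ · (d Q) = n₁ P`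
  set Q₁ : ℤ_[p]⟦X⟧ := C (d : ℤ_[p]) * Q.map (Int.castRingHom ℤ_[p]) with hQ₁
  set P₁ : ℤ_[p]⟦X⟧ := C (n₁ : ℤ_[p]) * P.map (Int.castRingHom ℤ_[p]) with hP₁
  have hintQ : ∀ R : ℤ⟦X⟧, (R.map (Int.castRingHom ℤ_[p])).map (algebraMap ℤ_[p] ℚ_[p]) =
      (R.map (Int.castRingHom ℚ)).map φ := fun R ↦ by
    ext n
    simp [coeff_map]
  have hPQp : zp * (Q.map (Int.castRingHom ℚ)).map φ = (P.map (Int.castRingHom ℚ)).map φ := by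
    rw [hzp, ← map_mul, hPQ]
  have hQ₁0 : Q₁ ≠ 0 := by
    rw [hQ₁]
    refine mul_ne_zero ?_ ?_
    · intro h0
      have h := congrArg constantCoeff h0
      rw [constantCoeff_C, map_zero, Nat.cast_eq_zero] at h
      exact hd0.ne' h
    · intro h0
      apply hQ
      apply PowerSeries.map_injective (Int.castRingHom ℤ_[p]) Int.cast_injective
      rw [h0, map_zero]
  have hPQ₁ : z₀ * Q₁.map (algebraMap ℤ_[p] ℚ_[p]) = P₁.map (algebraMap ℤ_[p] ℚ_[p]) := by
    have e₁ : Q₁.map (algebraMap ℤ_[p] ℚ_[p]) = C (d : ℚ_[p]) * (Q.map (Int.castRingHom ℚ)).map φ := by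
      rw [hQ₁, map_mul, map_C, map_natCast (algebraMap ℤ_[p] ℚ_[p]) d, hintQ]
    have e₂ : P₁.map (algebraMap ℤ_[p] ℚ_[p]) = C (n₁ : ℚ_[p]) * (P.map (Int.castRingHom ℚ)).map φ := by
      rw [hP₁, map_mul, map_C, map_natCast (algebraMap ℤ_[p] ℚ_[p]) n₁, hintQ]
    have e₃ : C (Cp.u : ℚ_[p]) * C (d : ℚ_[p]) = (C (n₁ : ℚ_[p]) : ℚ_[p]⟦X⟧) := by
      rw [← map_mul, mul_comm, hdu]
    rw [e₁, e₂, hz₀, mul_mul_mul_comm, e₃, hPQp]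
  have hGz : G₁.subst z₀ = w₁.map (algebraMap ℤ_[p] ℚ_[p]) := by
    rw [← subst_map_algebraMap G₁ hz₀s, halg, hG₁, hGw, ← hw₁]
  obtain ⟨z₁, hz₁⟩ :=
    Literature.RingTheory.PowerSeries.padicInt_exists_map_eq_of_subst_eq_map hdd hunit hz₀0 hGz
      hQ₁0 hPQ₁
  /- Step 9: `u = [X¹](u z) ∈ ℤ_p`. -/
  have h1 : (algebraMap ℤ_[p] ℚ_[p]) (coeff 1 z₁) = (Cp.u : ℚ_[p]) := by
    rw [← hz₀1, ← hz₁, coeff_map]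
  rw [← h1]
  exact PadicInt.norm_le_one _

/-- **The Manin-constant multiplier is a `p`-adic integer at every multiplicative prime `p ≥ 5`.**
For the data of `edixhoven_int_of_neronLattice_eq_smul_periodLattice` and a prime `p ≥ 5` with
`p ∣ Δ_min(W')`, `p ∤ c₄(W')` (multiplicative reduction, Silverman VII.5.1(b)): `‖q‖_p ≤ 1`
(for the strong Weil curve `|q| = c_f`: the case "`p ≥ 5`, `p ∥ N`" of `v_p(N) ≤ 1 ⇒ p ∤ c_f`,
Mazur 1978 / Abbes–Ullmo 1996, cf. Pasten 2024 §10.1; here by finite height + Honda at a node).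
[cite: EdixhovenManin1991, Prop. 2] [cite: PastenShimura2024, §10.1 (p. 33)]
[cite: Honda1970, Thm. 9 (pp. 240–241)] -/
theorem padicNorm_le_one_of_neronLattice_eq_smul_periodLattice_of_dvd_of_not_dvd {N : ℕ} [NeZero N]
    {W' : WeierstrassCurve ℚ} [W'.IsElliptic] [W'.IsGloballyMinimal] {f : CuspForm (Gamma0 N) 2}
    {L' : PeriodPair} (hf : IsNewformOf W' f) (hL' : IsNeronLatticeOf (W'.baseChange ℂ) L')
    {q : ℚ} (hq : ∀ z ∈ periodLattice f, (q : ℂ) * z ∈ L'.lattice)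
    (hq' : ∀ z ∈ L'.lattice, ∃ w ∈ periodLattice f, z = q * w)
    {p : ℕ} [Fact p.Prime] (hp5 : 5 ≤ p) (hΔ : (p : ℤ) ∣ minimalDiscriminantInt W')
    (hc₄ : ¬ (p : ℤ) ∣ (integralModelInt W').c₄) : ‖(q : ℚ_[p])‖ ≤ 1 := by
  refine padicNorm_le_one_of_neronLattice_eq_smul_periodLattice_of_formalMul_ne_zero hf hL' hq hq'
    hp5 ?_ (W'.exists_padicInt_formalLog_subst_eq_lSeriesLog_of_dvd_of_not_dvd hΔ hc₄)
  have h := ((integralModelInt W').map (Int.castRingHom ℤ_[p])).formalMul_prime_map_toZMod_ne_zero_of_nodal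
    ?_ ?_
  · rwa [map_toZMod_integralModelInt] at h
  · rw [map_toZMod_integralModelInt, map_Δ, eq_intCast, ZMod.intCast_zmod_eq_zero_iff_dvd]
    exact hΔ
  · rw [map_toZMod_integralModelInt, map_c₄, eq_intCast, Ne, ZMod.intCast_zmod_eq_zero_iff_dvd]
    exact hc₄

/-- **`‖q‖_p ≤ 1` at every prime `p ≥ 5` that is not a prime of additive reduction**
(`¬ (p ∣ Δ_min(W') ∧ p ∣ c₄(W'))`: good or multiplicative reduction, Silverman VII.5.1) — the
good-prime theorem `padicNorm_le_one_of_neronLattice_eq_smul_periodLattice` and the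
multiplicative-prime theorem above. [cite: EdixhovenManin1991, Prop. 2]
[cite: PastenShimura2024, §10.1 (p. 33)] -/
theorem padicNorm_le_one_of_neronLattice_eq_smul_periodLattice_of_not_additive {N : ℕ} [NeZero N]
    {W' : WeierstrassCurve ℚ} [W'.IsElliptic] [W'.IsGloballyMinimal] {f : CuspForm (Gamma0 N) 2}
    {L' : PeriodPair} (hf : IsNewformOf W' f) (hL' : IsNeronLatticeOf (W'.baseChange ℂ) L')
    {q : ℚ} (hq : ∀ z ∈ periodLattice f, (q : ℂ) * z ∈ L'.lattice)
    (hq' : ∀ z ∈ L'.lattice, ∃ w ∈ periodLattice f, z = q * w)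
    {p : ℕ} [Fact p.Prime] (hp5 : 5 ≤ p)
    (hadd : ¬ ((p : ℤ) ∣ minimalDiscriminantInt W' ∧ (p : ℤ) ∣ (integralModelInt W').c₄)) :
    ‖(q : ℚ_[p])‖ ≤ 1 := by
  by_cases hΔ : (p : ℤ) ∣ minimalDiscriminantInt W'
  · exact padicNorm_le_one_of_neronLattice_eq_smul_periodLattice_of_dvd_of_not_dvd hf hL' hq hq' hp5 hΔ
      fun hc ↦ hadd ⟨hΔ, hc⟩
  · exact padicNorm_le_one_of_neronLattice_eq_smul_periodLattice hf hL' hq hq' hp5 hΔ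

/-- **Corollary: every prime factor of `den q` is `2`, `3`, or a prime of additive reduction of
`W'`** (`p ∣ Δ_min(W')` and `p ∣ c₄(W')`). For the strong Weil curve (`|q| = c_f`): the Manin
constant is a unit at every `p ≥ 5` with `v_p(N) ≤ 1` (Mazur; Abbes–Ullmo) — of course `c_f ∈ ℤ`
(Edixhoven's Prop. 2, the named fact this file supports). [cite: EdixhovenManin1991, Prop. 2]
[cite: PastenShimura2024, §10.1 (p. 33)] -/
theorem dvd_six_or_additive_of_dvd_den_of_neronLattice_eq_smul_periodLattice {N : ℕ} [NeZero N]
    {W' : WeierstrassCurve ℚ} [W'.IsElliptic] [W'.IsGloballyMinimal] {f : CuspForm (Gamma0 N) 2}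
    {L' : PeriodPair} (hf : IsNewformOf W' f) (hL' : IsNeronLatticeOf (W'.baseChange ℂ) L')
    {q : ℚ} (hq : ∀ z ∈ periodLattice f, (q : ℂ) * z ∈ L'.lattice)
    (hq' : ∀ z ∈ L'.lattice, ∃ w ∈ periodLattice f, z = q * w)
    {p : ℕ} (hp : p.Prime) (hpq : p ∣ q.den) :
    p ∣ 6 ∨ ((p : ℤ) ∣ minimalDiscriminantInt W' ∧ (p : ℤ) ∣ (integralModelInt W').c₄) := by
  haveI := Fact.mk hp
  by_contra hcon
  rw [not_or] at hcon
  have hp2 : p ≠ 2 := by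
    rintro rfl; exact hcon.1 (by norm_num)
  have hp3 : p ≠ 3 := by
    rintro rfl; exact hcon.1 (by norm_num)
  have hp5 : 5 ≤ p := by
    have h2 := hp.two_le
    rcases Nat.lt_or_ge p 5 with h | h
    · interval_cases p
      · exact absurd rfl hp2
      · exact absurd rfl hp3
      · exact absurd hp (by decide)
    · exact h
  have hle := padicNorm_le_one_of_neronLattice_eq_smul_periodLattice_of_not_additive hf hL' hq hq' hp5 hcon.2
  -- `‖q‖_p ≤ 1` contradicts `p ∣ den q`
  have hlt : 1 < ‖(q : ℚ_[p])‖ := by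
    have hqden : ‖((q.den : ℤ) : ℚ_[p])‖ < 1 :=
      Padic.norm_intCast_lt_one_iff.mpr (Int.natCast_dvd_natCast.mpr hpq)
    have hnum : ‖((q.num : ℤ) : ℚ_[p])‖ = 1 := by
      refine le_antisymm (Padic.norm_int_le_one _) (not_lt.mp fun h ↦ ?_)
      have hpn : p ∣ q.num.natAbs := Int.natCast_dvd.mp (Padic.norm_intCast_lt_one_iff.mp h)
      have h1 : p ∣ 1 := by
        have h' := Nat.dvd_gcd hpn hpq
        rwa [Nat.Coprime.gcd_eq_one q.reduced] at h'
      exact hp.ne_one (Nat.dvd_one.mp h1)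
    have hq' : (q : ℚ_[p]) = ((q.num : ℤ) : ℚ_[p]) / ((q.den : ℤ) : ℚ_[p]) := by
      rw [Int.cast_natCast, ← Rat.cast_intCast, ← Rat.cast_natCast, ← Rat.cast_div, Rat.num_div_den]
    have hden0 : 0 < ‖((q.den : ℤ) : ℚ_[p])‖ := by
      rw [norm_pos_iff, Int.cast_natCast, Nat.cast_ne_zero]
      exact q.den_nz
    rw [hq', norm_div, hnum, one_div, one_lt_inv₀ hden0]
    exact hqden
  exact absurd hle (not_le.mpr hlt)

/-- **For a semistable `W'` (no prime of additive reduction) the denominator of `q` is a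
`{2, 3}`-number**: every prime factor of `den q` is `2` or `3` (for the strong Weil curve of
square-free conductor: `c_f` is a `{2, 3}`-unit… given `c_f ∈ ℤ`, cf. Mazur 1978, Cor. 4.1, and
Abbes–Ullmo 1996). [cite: EdixhovenManin1991, Prop. 2] [cite: PastenShimura2024, §10.1 (p. 33)] -/
theorem eq_two_or_eq_three_of_dvd_den_of_semistable {N : ℕ} [NeZero N]
    {W' : WeierstrassCurve ℚ} [W'.IsElliptic] [W'.IsGloballyMinimal] {f : CuspForm (Gamma0 N) 2}
    {L' : PeriodPair} (hf : IsNewformOf W' f) (hL' : IsNeronLatticeOf (W'.baseChange ℂ) L')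
    {q : ℚ} (hq : ∀ z ∈ periodLattice f, (q : ℂ) * z ∈ L'.lattice)
    (hq' : ∀ z ∈ L'.lattice, ∃ w ∈ periodLattice f, z = q * w)
    (hss : ∀ ℓ : ℕ, ℓ.Prime → (ℓ : ℤ) ∣ minimalDiscriminantInt W' → ¬ (ℓ : ℤ) ∣ (integralModelInt W').c₄)
    {p : ℕ} (hp : p.Prime) (hpq : p ∣ q.den) : p = 2 ∨ p = 3 := by
  rcases dvd_six_or_additive_of_dvd_den_of_neronLattice_eq_smul_periodLattice hf hL' hq hq' hp hpq with
    h6 | ⟨hΔ, hc₄⟩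
  · rcases (Nat.Prime.dvd_mul hp).mp (show p ∣ 2 * 3 from h6) with h | h
    · exact Or.inl ((Nat.prime_dvd_prime_iff_eq hp Nat.prime_two).mp h)
    · exact Or.inr ((Nat.prime_dvd_prime_iff_eq hp Nat.prime_three).mp h)
  · exact absurd hc₄ (hss p hp hΔ)

end Literature.NumberTheory.EllipticCurves
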